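import Literature.NumberTheory.K2Lit.AdelicPlaceSplitting
import Literature.MeasureTheory.RestrictedProduct.Haar
import Literature.NumberTheory.Automorphic.UnitaryGroupPureTensorEulerProduct
import Literature.NumberTheory.Automorphic.AdelicSecondCountable
import Mathlib.MeasureTheory.Measure.Haar.Unique
import Mathlib.MeasureTheory.Measure.WithDensity
import Mathlib.MeasureTheory.Integral.Prod

/-!
# Socket #21s `sig_K2LiuAdelicPlaceSplittingFubini` — a Haar measure of a restricted product splits as a
# product of Haar measures at a finite set of indices (organ (LS0) of the LOCAL SEAM of s23)

Track B ∕ K2-LIT, hLiu418 = stmt-HodgeConjecture-24832, unit U5b «LOCAL SEAM OF s23», socket #21s of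
`Summits/HodgeConjecture/HodgeConjecture/Cruxes/HLiu418/Lines/K2_Liu_CurveThetaSigs_U5b_LocalSeam.lean` (ED. 1), over the
DEFS leaf ★ `Literature/NumberTheory/K2Lit/AdelicPlaceSplitting.lean` (p855351, `PlaceSplitting.splitEquiv`).

* §1 `adelicPlaceSplittingFubini` — THE SOCKET, bytes verbatim: for countably many second-countable Hausdorff locally
  compact groups `G i` with compact open subgroups `B i`, a finite set `S` and a Haar measure `μ` on `Πʳ i, [G i, B i]`,
  there are Haar measures `μS` on `Π i : S, G i` and `μ'` on `Πʳ j : {i // i ∉ S}, [G j, B j]` with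
  `(splitEquiv G B S)_* μ = μS ⊗ μ'`.  Proof: the push-forward along the topological-group isomorphism ★ `splitEquiv`
  is a Haar measure (Mathlib `ContinuousMulEquiv.isHaarMeasure_map`); so is `haar ⊗ haar`; Haar measure on the
  second-countable locally compact product is unique up to a positive scalar (Mathlib `isMulLeftInvariant_eq_smul`,
  `haarScalarFactor_pos_of_isHaarMeasure`), and the scalar is absorbed into the second factor (`prod_smul_right`).
* §2 corollaries in the shapes the consumers (#29s `DoublingPartialEuler`) use: `exists_measurePreserving_splitEquiv`
  (the `MeasurePreserving` form, with σ-finiteness recorded), `exists_lintegral_eq_lintegral_lintegral_glueS` (Tonelli: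
  `∫⁻ f dμ = ∫⁻_{Π_S G} ∫⁻_{Πʳ_{∉S}} f (glueS (a, y)) dμ' dμS` for measurable `f ≥ 0`) and
  `exists_integral_eq_integral_integral_glueS` (Fubini for integrable `F`).
* §3 `exists_map_splitPlaces_eq_prod` — the instantiation the LOCAL SEAM uses: for the finite-adelic unitary group
  `U(J)(𝔸_{F,f})` (★ `UnitaryGroup.finAdelic`) and a finite set `S` of places of `F`, every Haar measure `ν_f` satisfies
  `(splitPlaces F E c N J S)_* ν_f = ν_S ⊗ ν^S` with Haar measures `ν_S` on `Π_{v∈S} U(J)(F_v)` and `ν^S` on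
  `Πʳ_{v∉S} [U(J)(F_v), U(J)(𝒪_v)]` (★ `splitPlaces = finAdelicEquiv ≫ splitEquiv`; instances ★ `countable_heightOneSpectrum`,
  ★ `secondCountableTopology_localPi`, ★ `locallyCompactSpace_localPi`, ★ `isCompact_localInt`).

Everything is proved (Mathlib + tree); no `def`, no `instance`, no `notation`, no `sorry`; axioms ⊆ {propext,
Classical.choice, Quot.sound}.  The Borel structure of both restricted products is the tree's trace σ-algebra
★ `Literature.MeasureTheory.RestrictedProduct.instMeasurableSpace`, identified with the Borel σ-algebra by ★
`RestrictedProduct.borelSpace` (invoked with `haveI`, never as an instance).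
HONEST LABEL: HC_CM is proved only modulo the printed citations (2 remaining named inputs: hLiu418 =
stmt-HodgeConjecture-24832, h413 = stmt-HodgeConjecture-24833) until rung 0 closes; this file is unconditional and
does not move the counter.

References: J. Tate in Cassels–Fröhlich, *Algebraic Number Theory* (1967) Ch. XV §3.3 [CasselsFrohlichANT1967];
V. Platonov, A. Rapinchuk, *Algebraic Groups and Number Theory* (1994) §5.1 [PlatonovRapinchuk1994]; A. Borel,
H. Jacquet, Proc. Sympos. Pure Math. 33.1 (1979) §4.1 [BorelJacquet1979].
-/

set_option autoImplicit false

set_option linter.dupNamespace false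

noncomputable section

open scoped RestrictedProduct ENNReal NNReal
open MeasureTheory MeasureTheory.Measure Filter Set Topology

namespace Summit.HodgeConjecture.HodgeConjecture.Cruxes.HLiu418.K2LiuAdelicPlaceSplittingFubini

open Literature.NumberTheory.K2Lit.PlaceSplitting

/-! ## §0  Instances on the two restricted products (theorems, introduced by `haveI`) -/

section instances

variable {ι : Type} (G : ι → Type) [∀ i, Group (G i)] [∀ i, TopologicalSpace (G i)]
  (B : ∀ i, Subgroup (G i)) [hBo : Fact (∀ i, IsOpen (B i : Set (G i)))]

/-- The trace σ-algebra of `Πʳ i, [G i, B i]` is its Borel σ-algebra (★ `RestrictedProduct.borelSpace`).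
[cite: CasselsFrohlichANT1967, Ch. XV (Tate) §3.3] -/
theorem borelSpace_rp [Countable ι] [∀ i, SecondCountableTopology (G i)] [∀ i, MeasurableSpace (G i)]
    [∀ i, BorelSpace (G i)] : BorelSpace (Πʳ i, [G i, B i]) :=
  Literature.MeasureTheory.RestrictedProduct.borelSpace (fun i => (B i : Set (G i)))
    fun i => (hBo.out i).measurableSet

/-- `Πʳ i, [G i, B i]` is second countable (★ `RestrictedProduct.secondCountableTopology`).
[cite: CasselsFrohlichANT1967, Ch. XV (Tate) §3.2] -/
theorem secondCountableTopology_rp [Countable ι] [∀ i, SecondCountableTopology (G i)] :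
    SecondCountableTopology (Πʳ i, [G i, B i]) :=
  Literature.MeasureTheory.RestrictedProduct.secondCountableTopology (fun i => (B i : Set (G i))) hBo.out

/-- `Πʳ i, [G i, B i]` is locally compact when the `B i` are compact (Mathlib
`RestrictedProduct.locallyCompactSpace_of_group`). [cite: CasselsFrohlichANT1967, Ch. XV (Tate) §3.2] -/
theorem locallyCompactSpace_rp [∀ i, IsTopologicalGroup (G i)] [∀ i, LocallyCompactSpace (G i)]
    (hBc : ∀ i, IsCompact (B i : Set (G i))) : LocallyCompactSpace (Πʳ i, [G i, B i]) :=
  RestrictedProduct.locallyCompactSpace_of_group _ (Eventually.of_forall hBc)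

variable (S : Finset ι)

/-- The openness `Fact` outside `S` (★ `PlaceSplitting.fact_isOpen_compl`, restated for the binder shape used here).
[cite: PlatonovRapinchuk1994, §5.1] -/
theorem fact_isOpen_off : Fact (∀ j : {i // i ∉ S}, IsOpen (B j.1 : Set (G j.1))) :=
  fact_isOpen_compl G B S

/-- The trace σ-algebra of the factor `Πʳ j : {i // i ∉ S}, [G j, B j]` is its Borel σ-algebra.
[cite: CasselsFrohlichANT1967, Ch. XV (Tate) §3.3] -/
theorem borelSpace_off [Countable ι] [∀ i, SecondCountableTopology (G i)] [∀ i, MeasurableSpace (G i)]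
    [∀ i, BorelSpace (G i)] : BorelSpace (Πʳ j : {i // i ∉ S}, [G j.1, B j.1]) :=
  Literature.MeasureTheory.RestrictedProduct.borelSpace (fun j : {i // i ∉ S} => (B j.1 : Set (G j.1)))
    fun j => (hBo.out j.1).measurableSet

/-- The factor `Πʳ j : {i // i ∉ S}, [G j, B j]` is second countable. [cite: CasselsFrohlichANT1967, Ch. XV (Tate) §3.2] -/
theorem secondCountableTopology_off [Countable ι] [∀ i, SecondCountableTopology (G i)] :
    SecondCountableTopology (Πʳ j : {i // i ∉ S}, [G j.1, B j.1]) :=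
  Literature.MeasureTheory.RestrictedProduct.secondCountableTopology
    (fun j : {i // i ∉ S} => (B j.1 : Set (G j.1))) fun j => hBo.out j.1

/-- The factor `Πʳ j : {i // i ∉ S}, [G j, B j]` is locally compact when the `B i` are compact.
[cite: CasselsFrohlichANT1967, Ch. XV (Tate) §3.2] -/
theorem locallyCompactSpace_off [∀ i, IsTopologicalGroup (G i)] [∀ i, LocallyCompactSpace (G i)]
    (hBc : ∀ i, IsCompact (B i : Set (G i))) :
    LocallyCompactSpace (Πʳ j : {i // i ∉ S}, [G j.1, B j.1]) :=
  haveI := fact_isOpen_off G B S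
  RestrictedProduct.locallyCompactSpace_of_group _ (Eventually.of_forall fun j => hBc j.1)

end instances

/-! ## §1  The socket: a Haar measure splits as a product of Haar measures at a finite set of indices -/

/-- **Socket #21s (U5b ED. 1), organ (LS0) «HAAR SPLITS AT FINITELY MANY PLACES» — bytes verbatim.**  Countably many
second-countable Hausdorff locally compact groups `G i` with compact open subgroups `B i`, a finite set `S` of indices and
a Haar measure `μ` on `Πʳ i, [G i, B i]` (trace = Borel σ-algebra): there are Haar measures `μS` on `Π_{i∈S} G i` and
`μ'` on `Πʳ_{j∉S} [G j, B j]` with `(splitEquiv G B S)_* μ = μS ⊗ μ'`.  Proof: `(splitEquiv)_* μ` is a Haar measure on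
the product group (transport along a topological-group isomorphism); `haar ⊗ haar` is another; by uniqueness of Haar
measure on a second-countable locally compact group they differ by a positive finite scalar, absorbed into the second
factor. [cite: CasselsFrohlichANT1967, Ch. XV (Tate) §3.3] [cite: PlatonovRapinchuk1994, §5.1] [cite: BorelJacquet1979, §4.1] -/
theorem adelicPlaceSplittingFubini :
    ∀ {ι : Type} [Countable ι] [DecidableEq ι] (G : ι → Type) [∀ i, Group (G i)] [∀ i, TopologicalSpace (G i)]
      [∀ i, IsTopologicalGroup (G i)] [∀ i, T2Space (G i)] [∀ i, SecondCountableTopology (G i)]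
      [∀ i, LocallyCompactSpace (G i)] [∀ i, MeasurableSpace (G i)] [∀ i, BorelSpace (G i)]
      (B : ∀ i, Subgroup (G i)) [Fact (∀ i, IsOpen (B i : Set (G i)))],
      (∀ i, IsCompact (B i : Set (G i))) →
      ∀ (S : Finset ι) (μ : Measure (Πʳ i, [G i, B i])) [μ.IsHaarMeasure],
      ∃ (μS : Measure (Π i : S, G i.1)) (μ' : Measure (Πʳ j : {i // i ∉ S}, [G j.1, B j.1])),
        μS.IsHaarMeasure ∧ μ'.IsHaarMeasure ∧
          Measure.map (splitEquiv G B S) μ = μS.prod μ' := by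
  intro ι _ _ G _ _ _ _ _ _ _ _ B hBo hBc S μ hμ
  haveI := fact_isOpen_off G B S
  haveI := borelSpace_rp G B
  haveI := borelSpace_off G B S
  haveI := secondCountableTopology_off G B S
  haveI := locallyCompactSpace_rp G B hBc
  haveI := locallyCompactSpace_off G B S hBc
  -- reference Haar measures on the two factors
  let μS : Measure (Π i : S, G i.1) := haar
  let μ₀ : Measure (Πʳ j : {i // i ∉ S}, [G j.1, B j.1]) := haar
  haveI : (Measure.map (splitEquiv G B S) μ).IsHaarMeasure :=
    (splitEquiv G B S).isHaarMeasure_map μ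
  -- Haar uniqueness on the product group
  set c : ℝ≥0 := haarScalarFactor (Measure.map (splitEquiv G B S) μ) (μS.prod μ₀) with hc_def
  have hc : 0 < c := haarScalarFactor_pos_of_isHaarMeasure _ _
  have h : Measure.map (splitEquiv G B S) μ = (c : ℝ≥0∞) • μS.prod μ₀ :=
    isMulLeftInvariant_eq_smul _ _
  refine ⟨μS, (c : ℝ≥0∞) • μ₀, inferInstance, ?_, ?_⟩
  · exact IsHaarMeasure.smul μ₀ (by exact_mod_cast hc.ne') ENNReal.coe_ne_top
  · rw [h, Measure.prod_smul_right]

/-! ## §2  Corollaries: `MeasurePreserving`, Tonelli, Fubini -/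

section corollaries

variable {ι : Type} [Countable ι] [DecidableEq ι] (G : ι → Type) [∀ i, Group (G i)] [∀ i, TopologicalSpace (G i)]
  [∀ i, IsTopologicalGroup (G i)] [∀ i, T2Space (G i)] [∀ i, SecondCountableTopology (G i)]
  [∀ i, LocallyCompactSpace (G i)] [∀ i, MeasurableSpace (G i)] [∀ i, BorelSpace (G i)]
  (B : ∀ i, Subgroup (G i)) [hBo : Fact (∀ i, IsOpen (B i : Set (G i)))]

/-- **`MeasurePreserving` form** (with σ-finiteness of both factors recorded): `splitEquiv G B S` carries `μ` to a product
`μS ⊗ μ'` of σ-finite Haar measures. [cite: CasselsFrohlichANT1967, Ch. XV (Tate) §3.3] [cite: PlatonovRapinchuk1994, §5.1] -/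
theorem exists_measurePreserving_splitEquiv (hBc : ∀ i, IsCompact (B i : Set (G i))) (S : Finset ι)
    (μ : Measure (Πʳ i, [G i, B i])) [μ.IsHaarMeasure] :
    ∃ (μS : Measure (Π i : S, G i.1)) (μ' : Measure (Πʳ j : {i // i ∉ S}, [G j.1, B j.1])),
      μS.IsHaarMeasure ∧ μ'.IsHaarMeasure ∧ SigmaFinite μS ∧ SigmaFinite μ' ∧
        MeasurePreserving (splitEquiv G B S) μ (μS.prod μ') := by
  obtain ⟨μS, μ', hS, h', hmap⟩ := adelicPlaceSplittingFubini G B hBc S μ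
  haveI := fact_isOpen_off G B S
  haveI := borelSpace_rp G B
  haveI := borelSpace_off G B S
  haveI := secondCountableTopology_off G B S
  haveI := locallyCompactSpace_off G B S hBc
  haveI := hS
  haveI := h'
  exact ⟨μS, μ', hS, h', inferInstance, inferInstance, ⟨(splitEquiv G B S).continuous.measurable, hmap⟩⟩

/-- **Tonelli over the splitting**: for every measurable `f ≥ 0` on `Πʳ i, [G i, B i]`,
`∫⁻ f dμ = ∫⁻_{a ∈ Π_S G} ∫⁻_{y ∈ Πʳ_{∉S}} f (glueS (a, y)) dμ' dμS`. [cite: CasselsFrohlichANT1967, Ch. XV (Tate) §3.3]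
[cite: BorelJacquet1979, §4.1] -/
theorem exists_lintegral_eq_lintegral_lintegral_glueS (hBc : ∀ i, IsCompact (B i : Set (G i))) (S : Finset ι)
    (μ : Measure (Πʳ i, [G i, B i])) [μ.IsHaarMeasure] :
    ∃ (μS : Measure (Π i : S, G i.1)) (μ' : Measure (Πʳ j : {i // i ∉ S}, [G j.1, B j.1])),
      μS.IsHaarMeasure ∧ μ'.IsHaarMeasure ∧ SigmaFinite μS ∧ SigmaFinite μ' ∧
        Measure.map (splitEquiv G B S) μ = μS.prod μ' ∧
        ∀ f : (Πʳ i, [G i, B i]) → ℝ≥0∞, Measurable f →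
          ∫⁻ x, f x ∂μ = ∫⁻ a, ∫⁻ y, f (glueS G B S (a, y)) ∂μ' ∂μS := by
  obtain ⟨μS, μ', hS, h', hσS, hσ', hmp⟩ := exists_measurePreserving_splitEquiv G B hBc S μ
  haveI := fact_isOpen_off G B S
  haveI := borelSpace_rp G B
  haveI := borelSpace_off G B S
  haveI := hσS
  haveI := hσ'
  refine ⟨μS, μ', hS, h', hσS, hσ', hmp.map_eq, fun f hf => ?_⟩
  have hsymm : MeasurePreserving (splitEquiv G B S).symm (μS.prod μ') μ :=
    hmp.symm (splitEquiv G B S).toHomeomorph.toMeasurableEquiv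
  rw [← hsymm.lintegral_comp hf]
  refine (lintegral_prod (fun z => f ((splitEquiv G B S).symm z)) ?_).trans ?_
  · exact (hf.comp hsymm.measurable).aemeasurable
  · rfl

/-- **Fubini over the splitting**: for every `μ`-integrable `F : Πʳ i, [G i, B i] → E` (`E` a complete normed space),
`∫ F dμ = ∫_{a ∈ Π_S G} ∫_{y ∈ Πʳ_{∉S}} F (glueS (a, y)) dμ' dμS`, and `(a, y) ↦ F (glueS (a, y))` is `μS ⊗ μ'`-integrable.
[cite: CasselsFrohlichANT1967, Ch. XV (Tate) §3.3] [cite: BorelJacquet1979, §4.1] -/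
theorem exists_integral_eq_integral_integral_glueS {E : Type} [NormedAddCommGroup E] [NormedSpace ℝ E]
    [CompleteSpace E] (hBc : ∀ i, IsCompact (B i : Set (G i))) (S : Finset ι)
    (μ : Measure (Πʳ i, [G i, B i])) [μ.IsHaarMeasure] :
    ∃ (μS : Measure (Π i : S, G i.1)) (μ' : Measure (Πʳ j : {i // i ∉ S}, [G j.1, B j.1])),
      μS.IsHaarMeasure ∧ μ'.IsHaarMeasure ∧ SigmaFinite μS ∧ SigmaFinite μ' ∧
        Measure.map (splitEquiv G B S) μ = μS.prod μ' ∧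
        ∀ F : (Πʳ i, [G i, B i]) → E, Integrable F μ →
          Integrable (fun p : (Π i : S, G i.1) × (Πʳ j : {i // i ∉ S}, [G j.1, B j.1]) => F (glueS G B S p))
              (μS.prod μ') ∧
            ∫ x, F x ∂μ = ∫ a, ∫ y, F (glueS G B S (a, y)) ∂μ' ∂μS := by
  obtain ⟨μS, μ', hS, h', hσS, hσ', hmp⟩ := exists_measurePreserving_splitEquiv G B hBc S μ
  haveI := fact_isOpen_off G B S
  haveI := borelSpace_rp G B
  haveI := borelSpace_off G B S
  haveI := hσS
  haveI := hσ'
  refine ⟨μS, μ', hS, h', hσS, hσ', hmp.map_eq, fun F hF => ?_⟩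
  have hsymm : MeasurePreserving (splitEquiv G B S).symm (μS.prod μ') μ :=
    hmp.symm (splitEquiv G B S).toHomeomorph.toMeasurableEquiv
  have hint : Integrable (fun p : (Π i : S, G i.1) × (Πʳ j : {i // i ∉ S}, [G j.1, B j.1]) =>
      F (glueS G B S p)) (μS.prod μ') := by
    have := hsymm.integrable_comp_emb
      (splitEquiv G B S).symm.toHomeomorph.toMeasurableEquiv.measurableEmbedding (g := F)
    exact this.2 hF
  refine ⟨hint, ?_⟩
  rw [← integral_prod _ hint]
  exact (hsymm.integral_comp (splitEquiv G B S).symm.toHomeomorph.toMeasurableEquiv.measurableEmbedding F).symm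

end corollaries

/-! ## §3  The finite-adelic unitary group split at a finite set of places -/

section unitary

open NumberField IsDedekindDomain
open Literature.NumberTheory.Automorphic

variable (F E : Type) [Field F] [NumberField F] [Field E] [NumberField E] [Algebra F E]
  (c : E ≃ₐ[F] E) (N : ℕ) (J : Matrix (Fin N) (Fin N) E)
  (S : Finset (HeightOneSpectrum (𝓞 F))) [DecidableEq (HeightOneSpectrum (𝓞 F))]
  [∀ v : HeightOneSpectrum (𝓞 F), MeasurableSpace (UnitaryGroup.localPi E c N J v)]
  [∀ v : HeightOneSpectrum (𝓞 F), BorelSpace (UnitaryGroup.localPi E c N J v)]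
  [MeasurableSpace (UnitaryGroup.finAdelic F E c N J)] [BorelSpace (UnitaryGroup.finAdelic F E c N J)]

/-- **`(splitPlaces)_* ν_f = ν_S ⊗ ν^S` on `U(J)(𝔸_{F,f})`.**  For every Haar measure `ν_f` on the finite-adelic unitary group
★ `UnitaryGroup.finAdelic F E c N J` and every finite set `S` of finite places of `F` there are Haar measures `ν_S` on
`Π_{v∈S} U(J)(F_v)` and `ν^S` on `Πʳ_{v∉S} [U(J)(F_v), U(J)(𝒪_v)]` (σ-finite) with `(splitPlaces F E c N J S)_* ν_f = ν_S ⊗ ν^S`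
— §1 for `G := localPi`, `B := localInt` (compact open, ★ `isCompact_localInt` ∕ `isOpen_localInt`), transported along ★
`finAdelicEquiv` (`splitPlaces = finAdelicEquiv ≫ splitEquiv`).  This is the «`G(𝔸_f) = G(F_S) × G(𝔸_f^S)`» Fubini
`∫_{U(V)(𝔸_f)} = ∫_{U(V)(F_S)} ∫_{U(V)(𝔸_f^S)}` of the local seam (DEPMAP v2.1 (LS0)–(LS1)).
[cite: PlatonovRapinchuk1994, §5.1] [cite: BorelJacquet1979, §4.1] [cite: CasselsFrohlichANT1967, Ch. XV (Tate) §3.3] -/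
theorem exists_map_splitPlaces_eq_prod (μ : Measure (UnitaryGroup.finAdelic F E c N J)) [μ.IsHaarMeasure] :
    ∃ (μS : Measure (Π v : S, UnitaryGroup.localPi E c N J v.1))
      (μ' : Measure (Πʳ v : {v // v ∉ S}, [UnitaryGroup.localPi E c N J v.1, UnitaryGroup.localInt E c N J v.1])),
      μS.IsHaarMeasure ∧ μ'.IsHaarMeasure ∧ SigmaFinite μS ∧ SigmaFinite μ' ∧
        Measure.map (splitPlaces F E c N J S) μ = μS.prod μ' := by
  haveI : Countable (HeightOneSpectrum (𝓞 F)) := countable_heightOneSpectrum F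
  haveI : ∀ v, SecondCountableTopology (UnitaryGroup.localPi E c N J v) :=
    fun v => UnitaryGroup.secondCountableTopology_localPi E N c J v
  haveI : ∀ v, LocallyCompactSpace (UnitaryGroup.localPi E c N J v) :=
    fun v => UnitaryGroup.locallyCompactSpace_localPi E N c J v
  have hBc : ∀ v, IsCompact (UnitaryGroup.localInt E c N J v : Set (UnitaryGroup.localPi E c N J v)) :=
    fun v => UnitaryGroup.isCompact_localInt E c N J v
  haveI := borelSpace_rp (fun v => UnitaryGroup.localPi E c N J v) (fun v => UnitaryGroup.localInt E c N J v)
  -- transport `μ` to the restricted-product model along ★ `finAdelicEquiv`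
  set μrp := Measure.map (UnitaryGroup.finAdelicEquiv F E c N J) μ with hμrp
  haveI : μrp.IsHaarMeasure := (UnitaryGroup.finAdelicEquiv F E c N J).isHaarMeasure_map μ
  obtain ⟨μS, μ', hS, h', hσS, hσ', hmp⟩ :=
    exists_measurePreserving_splitEquiv (fun v => UnitaryGroup.localPi E c N J v)
      (fun v => UnitaryGroup.localInt E c N J v) hBc S μrp
  refine ⟨μS, μ', hS, h', hσS, hσ', ?_⟩
  have hcomp : (⇑(splitPlaces F E c N J S) : UnitaryGroup.finAdelic F E c N J → _) =
      ⇑(splitEquiv (fun v => UnitaryGroup.localPi E c N J v) (fun v => UnitaryGroup.localInt E c N J v) S) ∘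
        ⇑(UnitaryGroup.finAdelicEquiv F E c N J) := rfl
  have hm₁ : Measurable (⇑(UnitaryGroup.finAdelicEquiv F E c N J) : UnitaryGroup.finAdelic F E c N J → _) :=
    (UnitaryGroup.finAdelicEquiv F E c N J).continuous.measurable
  rw [hcomp, ← Measure.map_map hmp.measurable hm₁]
  exact hmp.map_eq

end unitary

end Summit.HodgeConjecture.HodgeConjecture.Cruxes.HLiu418.K2LiuAdelicPlaceSplittingFubini

end
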